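import Summits.NavierStokesRegularity.NavierStokesRegularity.Theorems.OddMorawetzLocal.Negative.OddMorawetzLocalParity
import Summits.NavierStokesRegularity.NavierStokesRegularity.Theorems.OddMorawetzLocal.Negative.OddMorawetzLocalB3Reduction

/-!
# Crux `OddMorawetzLocal` (stmt-NavierStokesRegularity-1376) — the two reductions combined

`oddMorawetzLocal_iff_odd_b3Invariant`: the crux holds iff it has a witness `(k, m)` with `k` ODD (parity,
`OddMorawetzLocalParity`) and `m` invariant under the hyperoctahedral group `B₃` (averaging,
`OddMorawetzLocalB3Reduction`) — the same witness: average first, then apply the parity obstruction to the averaged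
witness. This is the normal form of the hunt used by the refutation programme (evidence `REFUTATION-BLUEPRINT.md` on
the item): weights `k ∈ {1, 3, 5}`, densities in the explicit finite-dimensional spaces of `B₃`-orbit sums.
Everything is proved; no definitions, no named facts.
-/

noncomputable section

open MeasureTheory
open Literature.Analysis Literature.Analysis.FluidPDE

set_option linter.dupNamespace false

namespace Summit.NavierStokesRegularity.NavierStokesRegularity.Theorems

open OddMorawetz in
/-- **Normal form of the hunt.** `OddMorawetzLocal ↔ ∃ (k, m)` with `Odd k`, `m` `B₃`-invariant, and the crux's body. -/
theorem oddMorawetzLocal_iff_odd_b3Invariant :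
    Summit.NavierStokesRegularity.NavierStokesRegularity.Theses.OddMorawetz.OddMorawetzLocal ↔
      ∃ (k : ℕ) (m : EuclideanSpace ℝ (Fin 3) × (EuclideanSpace ℝ (Fin 3) [×1]→L[ℝ] EuclideanSpace ℝ (Fin 3)) × (EuclideanSpace ℝ (Fin 3) [×2]→L[ℝ] EuclideanSpace ℝ (Fin 3)) × (EuclideanSpace ℝ (Fin 3) [×3]→L[ℝ] EuclideanSpace ℝ (Fin 3)) → ℝ),
        Odd k ∧ (∀ (σ : Equiv.Perm (Fin 3)) (ε : Fin 3 → ℤˣ), m ∘ ⇑(jetAct (signedPerm σ ε)) = m) ∧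
        (let J := fun (v : EuclideanSpace ℝ (Fin 3) → EuclideanSpace ℝ (Fin 3)) (x : EuclideanSpace ℝ (Fin 3)) => (v x, iteratedFDeriv ℝ 1 v x, iteratedFDeriv ℝ 2 v x, iteratedFDeriv ℝ 3 v x); let Q := fun (v : EuclideanSpace ℝ (Fin 3) → EuclideanSpace ℝ (Fin 3)) => -∫ x, fderiv ℝ m (J v x) (J (Literature.Analysis.FluidPDE.eulerBilinear v v) x); k ≤ 5 ∧ ContDiff ℝ (⊤ : ℕ∞) m ∧ (∀ (μ : ℝ) z, m (μ • z) = μ ^ 3 * m z) ∧ (∀ (s : ℝ), 0 < s → ∀ (z₀ : EuclideanSpace ℝ (Fin 3)) (z₁ : EuclideanSpace ℝ (Fin 3) [×1]→L[ℝ] EuclideanSpace ℝ (Fin 3)) (z₂ : EuclideanSpace ℝ (Fin 3) [×2]→L[ℝ] EuclideanSpace ℝ (Fin 3)) (z₃ : EuclideanSpace ℝ (Fin 3) [×3]→L[ℝ] EuclideanSpace ℝ (Fin 3)), m (z₀, s • z₁, (s ^ 2) • z₂, (s ^ 3) • z₃) = s ^ k * m (z₀, z₁, z₂, z₃)) ∧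 (∀ v, Literature.Analysis.FluidPDE.IsSchwartzField v → Literature.Analysis.FluidPDE.VectorCalculus.IsDivFree v → 0 ≤ Q v) ∧ (∃ v, Literature.Analysis.FluidPDE.IsSchwartzField v ∧ Literature.Analysis.FluidPDE.VectorCalculus.IsDivFree v ∧ 0 < Q v)) := by
  constructor
  · intro h
    obtain ⟨k, m, hinv, hbody⟩ := OddMorawetz.oddMorawetzLocal_iff_b3Invariant.mp h
    refine ⟨k, m, ?_, hinv, hbody⟩
    obtain ⟨-, hm, hhom, hbi, hQ, v₀, hv₀, hd₀, hpos⟩ := hbody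
    exact OddMorawetzParity.odd_of_witness hm hhom hbi hQ hv₀ hd₀ hpos
  · rintro ⟨k, m, -, -, h⟩
    exact ⟨k, m, h⟩

end Summit.NavierStokesRegularity.NavierStokesRegularity.Theorems
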